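import Mathlib
import HarnessLib
import Summits.AtomisticToContinuum.Crystallization.Theorems.FrustratedLawDichotomyTwoShellRigidityLsFitReplayGeom

/-!
# Two-shell rigidity, slot 3 · the `SphericalLsFit` replay engine (5): the wrapper
# `checkAllF ⟹ SphericalLsFit β (1/100) Pat probes26 α Ω V₁ V₃`   (decomp-a2c, lens 3, gen 37)

Sequel of `…LsFitReplayGeom`, closing NODE «SphericalLsFitReplay» (rational interface in part (5b) `…LsFitReplayRat`): the certified check of a
fit run (`checkAllF m prm cells = true`, part 1) with probe table `ptab26` and integer parameters
`(B2, F0L, OM2, V1K, V3K)` dominating the real targets `(β, α, Ω, V₁, V₃)` proves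
`…LsLedger.SphericalLsFit β (1/100) fccKissingPattern probes26 α Ω V₁ V₃` (`sphericalLsFit_fcc_of_checkAllF`)
and the HCP analogue — the `hS` input of `…LsLedgerArrow.lsEntryAt_fcc_of_sphericalLsFit` /
`lsEntryAt_hcp_of_sphericalLsFit` (31280 slot 3).  Steps: reindex the dozen `e : Pat → ℝ³` by labels
(`patPt m : Fin 12 → Pat` is a bijection), transport the window hypotheses to the `Rig` frame
coordinates (`feasible_coords`, braces by `coords_dot`), select the chart and cell of the free point
(`coversChart_sound`), replay (`runCellF_sound`), read the leaf (`fit_geometry`), and transport the four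
conclusions back (`lsRot = lsRotL`, `derot = derotL` under the reindexing; the reversed bond direction
uses the central symmetry `ptab26_symm` of the probe table).
`[folklore]`; no `sorry`; no `instance`/`notation`; no data.
-/

namespace Summit.AtomisticToContinuum.Crystallization.Theorems

namespace Rig

open Literature.Geometry.DiscreteGeometry
open Literature.Analysis.ValidatedNumerics.NumericsMP
open Summit.AtomisticToContinuum.Crystallization.Theorems.FrustratedLawDichotomyTwoShellRigidityLsLedger
open Summit.AtomisticToContinuum.Crystallization.Theorems.FrustratedLawDichotomyTwoShellRigidityCut (E3)
open Summit.AtomisticToContinuum.Crystallization.Theorems.FrustratedLawDichotomyTwoShellRigidityGaugedLadder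
open scoped RealInnerProductSpace

/-! ### The probe table `ptab26` realises `probes26` -/

/-- `ptab26` is centrally symmetric. -/
theorem ptab26_symm : ∀ e ∈ ptab26, (-e.1, e.2) ∈ ptab26 := by decide

/-- The probe of the negated table entry is the negated probe. -/
theorem probeVec_neg (mv : Fin 3 → ℤ) (k : ℕ) : probeVec (-mv, k) = -probeVec (mv, k) := by
  apply ext3 <;> simp [probeVec]

/-- **`ptab26` realises `probes26`** (same order). -/
theorem map_probeVec_ptab26 : ptab26.map probeVec = probes26 := by
  simp only [ptab26, List.map_cons, List.map_nil, probes26, axisProbes, diagProbes, List.cons_append,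
    List.nil_append, List.cons.injEq, and_true]
  refine ⟨?_, ?_, ?_, ?_, ?_, ?_, ?_, ?_, ?_, ?_, ?_, ?_, ?_, ?_, ?_, ?_, ?_, ?_, ?_, ?_, ?_, ?_, ?_, ?_, ?_, ?_⟩
  all_goals (apply ext3 <;> simp [probeVec, vec3])

/-- Membership in `probes26` through the table. -/
theorem exists_ptab26_of_mem_probes26 {nv : E3} (h : nv ∈ probes26) : ∃ e ∈ ptab26, probeVec e = nv := by
  rw [← map_probeVec_ptab26, List.mem_map] at h
  exact h

/-! ### Pairs -/

/-- Membership in `allPairs`. -/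
theorem mem_allPairs {i j : Fin 12} : (i, j) ∈ allPairs ↔ i < j := by
  unfold allPairs
  simp only [List.mem_flatMap, List.mem_finRange, List.mem_filterMap, true_and]
  constructor
  · rintro ⟨i', j', h⟩
    by_cases hlt : i' < j'
    · rw [if_pos hlt] at h
      simp only [Option.some.injEq, Prod.mk.injEq] at h
      obtain ⟨rfl, rfl⟩ := h
      exact hlt
    · rw [if_neg hlt] at h
      exact absurd h (by simp)
  · intro h
    exact ⟨i, j, by rw [if_pos h]⟩

/-- Membership in `bondPairs`. -/
theorem mem_bondPairs {m : Model} {i j : Fin 12} (hij : i < j) (hb : m.bond i j = true) :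
    (i, j) ∈ bondPairs m := by
  unfold bondPairs
  rw [List.mem_filter]
  exact ⟨mem_allPairs.2 hij, hb⟩

/-! ### Pattern points -/

/-- Distance of two pattern points. -/
theorem dist_patPt {m : Model} (hN : 0 < m.normSq) (i j : Fin 12) :
    dist (patPt m i) (patPt m j) = Real.sqrt (sqNormInt (m.tab i - m.tab j)) / Real.sqrt m.normSq := by
  have hpos : (0 : ℝ) < Real.sqrt m.normSq := Real.sqrt_pos.2 (by exact_mod_cast hN)
  rw [patPt, patPt, dist_eq_norm, ← smul_sub, intVec_sub, norm_smul, norm_inv,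
    Real.norm_of_nonneg hpos.le, norm_intVec]
  ring

/-- `dist uᵢ uⱼ = 1 ↔ |tab i − tab j|² = N`. -/
theorem dist_patPt_eq_one_iff {m : Model} (hN : 0 < m.normSq) (i j : Fin 12) :
    dist (patPt m i) (patPt m j) = 1 ↔ sqNormInt (m.tab i - m.tab j) = m.normSq := by
  have hpos : (0 : ℝ) < Real.sqrt m.normSq := Real.sqrt_pos.2 (by exact_mod_cast hN)
  have hs0 : (0 : ℝ) ≤ (sqNormInt (m.tab i - m.tab j) : ℝ) := by
    have : (0 : ℤ) ≤ sqNormInt (m.tab i - m.tab j) := by unfold sqNormInt; positivity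
    exact_mod_cast this
  rw [dist_patPt hN, div_eq_one_iff_eq hpos.ne']
  constructor
  · intro h
    have h2 := congrArg (fun t => t ^ 2) h
    simp only [Real.sq_sqrt hs0, Real.sq_sqrt (Nat.cast_nonneg _)] at h2
    exact_mod_cast h2
  · intro h
    rw [show (sqNormInt (m.tab i - m.tab j) : ℝ) = (m.normSq : ℝ) by exact_mod_cast h]

/-- A brace pair is at distance `√2`. -/
theorem dist_patPt_of_brace {m : Model} (hN : 0 < m.normSq) {i j : Fin 12} (hb : m.brace i j = true) :
    dist (patPt m i) (patPt m j) = Real.sqrt 2 := by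
  have hNr : (0 : ℝ) < m.normSq := by exact_mod_cast hN
  have hpos : (0 : ℝ) < Real.sqrt m.normSq := Real.sqrt_pos.2 hNr
  unfold Model.brace at hb
  rw [decide_eq_true_eq, Fin.sum_univ_three] at hb
  have hs : sqNormInt (m.tab i - m.tab j) = 2 * (m.normSq : ℤ) := by
    rw [← hb]; simp [sqNormInt, Pi.sub_apply, sq]
  rw [dist_patPt hN, hs]
  push_cast
  rw [Real.sqrt_mul (by norm_num : (0:ℝ) ≤ 2), mul_div_assoc, div_self hpos.ne', mul_one]

/-- Pattern points are unit vectors. -/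
theorem dotZ_tab_self_of {m : Model} (h : ∀ i, sqNormInt (m.tab i) = m.normSq) (i : Fin 12) :
    dotZ (m.tab i) (m.tab i) = m.normSq := by
  rw [← h i]; simp [dotZ, sqNormInt, Fin.sum_univ_three]; ring

/-! ### The one-percent levels -/

/-- `1 − (1+θ)⁻²/2 = chiR` at `θ = 1/100`. -/
private theorem chiR_eq' : (1 : ℝ) - (1 + 1 / 100)⁻¹ ^ 2 / 2 = chiR := by rw [chiR]; norm_num
/-- `1 − (1+θ)²/2 = cbloR` at `θ = 1/100`. -/
private theorem cbloR_eq' : (1 : ℝ) - (1 + 1 / 100) ^ 2 / 2 = cbloR := by rw [cbloR]; norm_num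
/-- `(1+θ)/2 = cnbR` at `θ = 1/100`. -/
private theorem cnbR_eq' : ((1 : ℝ) + 1 / 100) / 2 = cnbR := by rw [cnbR]; norm_num

/-! ### The generic wrapper -/

/-- **From a certified fit run to `SphericalLsFit`** for a well-formed model realising the pattern
`Pat` (bijectively by `patPt`), with bonds = unit distances and braces at distance `√2`, probe table
`ptab26`, and integer parameters dominating `(β, α, Ω, V₁, V₃)`. -/
theorem sphericalLsFit_of_checkAllF {m : Model} (hW : m.WF) (hN : 0 < m.normSq)
    (htab : ∀ i, sqNormInt (m.tab i) = m.normSq) {Pat : Finset E3}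
    (hmem : ∀ i, patPt m i ∈ Pat) (hsurj : ∀ q ∈ Pat, ∃ i, q = patPt m i)
    (hinj : Function.Injective (patPt m))
    (hbond : ∀ i j, m.bond i j = true ↔ dist (patPt m i) (patPt m j) = 1)
    (hbrace : ∀ i j, m.brace i j = true → dist (patPt m i) (patPt m j) = Real.sqrt 2)
    {prm : FitPrm} {cells : List CellF} (hchk : checkAllF m prm cells = true) (hpt : prm.ptab = ptab26)
    {β α Ω V₁ V₃ : ℝ} (hB2 : β * (SC : ℝ) ^ 2 ≤ prm.B2) (hα : 0 ≤ α) (hΩ : 0 ≤ Ω)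
    (hF0 : (SC : ℝ) * Real.sqrt m.normSq * (1 - α ^ 2 / 2) ≤ prm.F0L)
    (hOM : (prm.OM2 : ℝ) ≤ 64 * m.normSq * Ω ^ 2 * (SC : ℝ) ^ 2)
    (hV1 : ∀ k, kOK k = true → (prm.V1K.getK k : ℝ) ≤ 8 * m.normSq * SC * Real.sqrt k * V₁)
    (hV3 : ∀ k, kOK k = true → (prm.V3K.getK k : ℝ) ≤ 8 * m.normSq * SC * Real.sqrt k * V₃) :
    SphericalLsFit β (1 / 100) Pat probes26 α Ω V₁ V₃ := by
  intro e he1 hchi hblo hnb hbr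
  -- labels
  let σ : Fin 12 → ↥Pat := fun i => ⟨patPt m i, hmem i⟩
  have hσinj : Function.Injective σ := fun i j h => hinj (congrArg Subtype.val h)
  have hσsurj : Function.Surjective σ := fun u => by
    obtain ⟨i, hi⟩ := hsurj u u.2
    exact ⟨i, Subtype.ext hi.symm⟩
  let ε : Fin 12 ≃ ↥Pat := Equiv.ofBijective σ ⟨hσinj, hσsurj⟩
  have hε : ∀ i, (ε i : E3) = patPt m i := fun i => rfl
  set p : Fin 12 → E3 := fun i => e (σ i) with hpdef
  -- the window hypotheses, labelled
  have hp1 : ∀ i, ‖p i‖ = 1 := fun i => he1 (σ i)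
  have hall : ∀ i j, i ≠ j → ⟪p i, p j⟫ ≤ chiR := fun i j hij =>
    chiR_eq' ▸ hchi (σ i) (σ j) (fun h => hij (hσinj h))
  have hbd : ∀ i j, i ≠ j → m.bond i j = true → cbloR ≤ ⟪p i, p j⟫ := fun i j _ hb =>
    cbloR_eq' ▸ hblo (σ i) (σ j) ((hbond i j).1 hb)
  have hnb' : ∀ i j, i ≠ j → m.bond i j = false → ⟪p i, p j⟫ ≤ cnbR := by
    intro i j hij hb
    have hd : dist (σ i : E3) (σ j : E3) ≠ 1 := fun h => by
      have := (hbond i j).2 h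
      rw [hb] at this
      exact Bool.false_ne_true this
    have h := hnb (σ i) (σ j) (fun h => hij (hσinj h)) hd
    rw [cnbR_eq'] at h
    exact h.le
  have hon := frame_orthonormal hW hp1 hall hbd
  set X := coords m p with hXdef
  have hF : Feasible m.bond X := feasible_coords hW hp1 hall hbd hnb'
  have hBr : BraceHolds m prm.B2 X := by
    intro i j hb
    have hd := hbrace i j hb
    have h := hbr (σ i) (σ j) hd
    rw [abs_le] at h
    have hX : X i ⬝ᵥ X j = ⟪p i, p j⟫ := coords_dot hon i j
    rw [hX]
    have hS : (0 : ℝ) ≤ (SC : ℝ) * SC := by positivity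
    constructor <;> nlinarith [h.1, h.2, hB2, hS]
  obtain ⟨hX0, hX1y, hX1x, hX2y⟩ := coords_frame_pts hW hp1 hall hbd
  -- the chart and the cell of the free point
  unfold checkAllF at hchk
  simp only [Bool.and_eq_true, List.all_eq_true] at hchk
  obtain ⟨⟨hcovT, hcovF⟩, hcells⟩ := hchk
  have hy := abs_coords_le_one hp1 hon m.free 1
  rw [abs_le] at hy
  have key : ∀ xp : Bool, coversChart (cells.map CellF.skel) xp = true →
      (if xp then 0 ≤ X m.free 0 else X m.free 0 ≤ 0) → FitVerified m prm X := by
    intro xp hcov hsign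
    obtain ⟨c, hc, hcx, htlo, hthi⟩ := coversChart_sound hcov (X m.free 1) hy.1 hy.2
    obtain ⟨cF, hcF, rfl⟩ := List.mem_map.1 hc
    have hcell : runCellF m prm cF = true := hcells cF hcF
    have hIn : InCell m cF.skel X := ⟨hX0, hX1y, hX1x, hX2y, htlo, hthi, by rw [hcx]; exact hsign⟩
    exact runCellF_sound hW hcell hF hBr hIn
  have hFV : FitVerified m prm X := by
    rcases le_or_gt 0 (X m.free 0) with h0 | h0
    · exact key true hcovT (by simpa using h0)
    · exact key false hcovF (by simpa using h0.le)
  obtain ⟨qw, qx, qy, qz, refl, hL⟩ := hFV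
  -- the leaf geometry
  obtain ⟨A, hG0, hG1, hG2, hG3⟩ := fit_geometry hN (dotZ_tab_self_of htab) hp1 (frameBasis hon) X
    (repr_eq_coords hon) hL hα hΩ hF0 hOM hV1 hV3
  -- transport back to the dozen indexed by the pattern
  have hres : ∀ i, frameRes A e (σ i) = A.symm (p i) - patPt m i := fun i => rfl
  have hsum : (∑ u : ↥Pat, cross (u : E3) (frameRes A e u)) =
      ∑ i, cross (patPt m i) (A.symm (p i) - patPt m i) := by
    rw [← Equiv.sum_comp ε]
    rfl
  have hls : lsRot Pat (frameRes A e) = lsRotL m (fun i => A.symm (p i) - patPt m i) := by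
    unfold lsRot lsRotL
    rw [hsum]
  have hder : ∀ i, derot Pat (frameRes A e) (σ i) = derotL m (fun i => A.symm (p i) - patPt m i) i := by
    intro i
    unfold derot derotL
    rw [hls]
    rfl
  refine ⟨A, fun u => ?_, ?_, fun nv hnv u => ?_, fun nv hnv u w huw => ?_⟩
  · obtain ⟨i, rfl⟩ := hσsurj u
    rw [hres]; exact hG0 i
  · rw [hls]; exact hG1
  · obtain ⟨i, rfl⟩ := hσsurj u
    obtain ⟨e', he', rfl⟩ := exists_ptab26_of_mem_probes26 hnv
    rw [hder]
    exact hG2 e' (hpt ▸ he') i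
  · obtain ⟨i, rfl⟩ := hσsurj u
    obtain ⟨j, rfl⟩ := hσsurj w
    obtain ⟨e', he', rfl⟩ := exists_ptab26_of_mem_probes26 hnv
    rw [hder, hder]
    have hb : m.bond i j = true := (hbond i j).2 huw
    have hij : i ≠ j := by
      intro h; subst h
      have : dist (σ i : E3) (σ i : E3) = 0 := dist_self _
      rw [this] at huw
      exact one_ne_zero huw.symm
    rcases lt_or_gt_of_ne hij with hlt | hgt
    · exact hG3 e' (hpt ▸ he') (i, j) (mem_bondPairs hlt hb)
    · have hb' : m.bond j i = true := by rw [hW.symm] at hb; exact hb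
      have h := hG3 (-e'.1, e'.2) (hpt ▸ ptab26_symm e' he') (j, i) (mem_bondPairs hgt hb')
      obtain ⟨mv, kk⟩ := e'
      rw [probeVec_neg, inner_neg_left, ← inner_neg_right, neg_sub] at h
      exact h

/-! ### The two patterns -/

/-- `patPt fccModel i ∈ fccKissingPattern`. -/
theorem patPt_mem_fcc (i : Fin 12) : patPt fccModel i ∈ fccKissingPattern := by
  rw [fccKissingPattern, scaledPattern, fccInt_eq_image, Finset.image_image, Finset.mem_image]
  exact ⟨i, Finset.mem_univ i, rfl⟩

/-- `patPt hcpModel i ∈ hcpKissingPattern`. -/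
theorem patPt_mem_hcp (i : Fin 12) : patPt hcpModel i ∈ hcpKissingPattern := by
  rw [hcpKissingPattern, scaledPattern, hcpInt_eq_image, Finset.image_image, Finset.mem_image]
  exact ⟨i, Finset.mem_univ i, rfl⟩

/-- `patPt fccModel` is injective. -/
theorem patPt_fcc_injective : Function.Injective (patPt fccModel) :=
  (scaledPattern_map_injective two_ne_zero).comp fccTab_injective

/-- `patPt hcpModel` is injective. -/
theorem patPt_hcp_injective : Function.Injective (patPt hcpModel) :=
  (scaledPattern_map_injective (by decide)).comp hcpTab_injective

/-- FCC bonds are the unit distances of the pattern. -/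
theorem fcc_bond_iff (i j : Fin 12) : fccModel.bond i j = true ↔ dist (patPt fccModel i) (patPt fccModel j) = 1 := by
  rw [dist_patPt_eq_one_iff (by decide)]
  simp [fccModel, fccAdj]

/-- HCP bonds are the unit distances of the pattern. -/
theorem hcp_bond_iff (i j : Fin 12) : hcpModel.bond i j = true ↔ dist (patPt hcpModel i) (patPt hcpModel j) = 1 := by
  rw [dist_patPt_eq_one_iff (by decide)]
  simp [hcpModel, hcpAdj]

/-- The FCC table vectors have squared norm `2`. -/
theorem sqNormInt_fccTab : ∀ i, sqNormInt (fccModel.tab i) = fccModel.normSq := by decide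

/-- The HCP table vectors have squared norm `18`. -/
theorem sqNormInt_hcpTab : ∀ i, sqNormInt (hcpModel.tab i) = hcpModel.normSq := by decide

/-- **FCC: a certified fit run proves `SphericalLsFit β (1/100) fccKissingPattern probes26 α Ω V₁ V₃`.**
(`N = 2`: `F0L ≥ S·√2·(1 − α²/2)`, `OM2 ≤ 128·Ω²·S²`, `V1K k ≤ 16·S·√k·V₁`, `V3K k ≤ 16·S·√k·V₃`.) -/
theorem sphericalLsFit_fcc_of_checkAllF {prm : FitPrm} {cells : List CellF}
    (hchk : checkAllF fccModel prm cells = true) (hpt : prm.ptab = ptab26)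
    {β α Ω V₁ V₃ : ℝ} (hB2 : β * (SC : ℝ) ^ 2 ≤ prm.B2) (hα : 0 ≤ α) (hΩ : 0 ≤ Ω)
    (hF0 : (SC : ℝ) * Real.sqrt 2 * (1 - α ^ 2 / 2) ≤ prm.F0L)
    (hOM : (prm.OM2 : ℝ) ≤ 64 * 2 * Ω ^ 2 * (SC : ℝ) ^ 2)
    (hV1 : ∀ k, kOK k = true → (prm.V1K.getK k : ℝ) ≤ 8 * 2 * SC * Real.sqrt k * V₁)
    (hV3 : ∀ k, kOK k = true → (prm.V3K.getK k : ℝ) ≤ 8 * 2 * SC * Real.sqrt k * V₃) :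
    SphericalLsFit β (1 / 100) fccKissingPattern probes26 α Ω V₁ V₃ :=
  sphericalLsFit_of_checkAllF fccModel_WF (by decide) sqNormInt_fccTab patPt_mem_fcc
    (fun _ hq => exists_patPt_of_mem_fcc hq) patPt_fcc_injective fcc_bond_iff
    (fun _ _ hb => dist_patPt_of_brace (by decide) hb) hchk hpt hB2 hα hΩ
    (by simpa [fccModel] using hF0) (by simpa [fccModel] using hOM)
    (by simpa [fccModel] using hV1) (by simpa [fccModel] using hV3)

/-- **HCP: a certified fit run proves `SphericalLsFit β (1/100) hcpKissingPattern probes26 α Ω V₁ V₃`.**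
(`N = 18`.) -/
theorem sphericalLsFit_hcp_of_checkAllF {prm : FitPrm} {cells : List CellF}
    (hchk : checkAllF hcpModel prm cells = true) (hpt : prm.ptab = ptab26)
    {β α Ω V₁ V₃ : ℝ} (hB2 : β * (SC : ℝ) ^ 2 ≤ prm.B2) (hα : 0 ≤ α) (hΩ : 0 ≤ Ω)
    (hF0 : (SC : ℝ) * Real.sqrt 18 * (1 - α ^ 2 / 2) ≤ prm.F0L)
    (hOM : (prm.OM2 : ℝ) ≤ 64 * 18 * Ω ^ 2 * (SC : ℝ) ^ 2)
    (hV1 : ∀ k, kOK k = true → (prm.V1K.getK k : ℝ) ≤ 8 * 18 * SC * Real.sqrt k * V₁)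
    (hV3 : ∀ k, kOK k = true → (prm.V3K.getK k : ℝ) ≤ 8 * 18 * SC * Real.sqrt k * V₃) :
    SphericalLsFit β (1 / 100) hcpKissingPattern probes26 α Ω V₁ V₃ :=
  sphericalLsFit_of_checkAllF hcpModel_WF (by decide) sqNormInt_hcpTab patPt_mem_hcp
    (fun _ hq => exists_patPt_of_mem_hcp hq) patPt_hcp_injective hcp_bond_iff
    (fun _ _ hb => dist_patPt_of_brace (by decide) hb) hchk hpt hB2 hα hΩ
    (by simpa [hcpModel] using hF0) (by simpa [hcpModel] using hOM)
    (by simpa [hcpModel] using hV1) (by simpa [hcpModel] using hV3)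

end Rig

end Summit.AtomisticToContinuum.Crystallization.Theorems
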